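import Mathlib.CategoryTheory.Limits.Shapes.BinaryProducts
import Literature.AnabelianGeometry.SemiGraphs.NotationsConventions
import HarnessLib

/-!
# Semi-graphs of anabelioids, §0 / Appendix: the functor `X ↦ (X × A → A)` from `C` to `C[A]`

Mochizuki, *Semi-graphs of anabelioids*, Publ. RIMS **42** (2006) 221–322, §0 p. 6
[cite: MochizukiSemiAnbd2006, §0 p.6]: "`C[A] ⊆ C`, the full subcategory determined by the objects of
`C` that admit a morphism to `A`" and "`j_A^* : C → C_A`, given by taking the product with `A`";
Appendix, proof of Theorem A.4, p. 85 (PRIMS p. 315) [cite: MochizukiSemiAnbd2006, Thm A.4 proof p.85]: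
every object `X` of the temperoid `T` is covered by the object `X × A` of `T[A]` — the device by which a
functor given on `Q = T[A]` is extended to `T` (row **A4-∃** of the abc-iut cell's
`plan/L3/SUBDAG-SemiAnbd-Cor311.md`, the coequaliser route to the existence half of Thm. A.4; holder's
cut 2026-08-26T03:36Z, item E0 (c); this file by seat abc-iut-w5-d220).

* `OverPrime.prodA A : C ⥤ C[A]`, `X ↦ (X ⨯ A, pr₂ : X ⨯ A → A)`, `f ↦ f ⨯ 𝟙_A` — Mathlib's
  `prod.functor.flip.obj A` lifted to the full subcategory `Over' A = C[A]` (`ObjectProperty.lift`);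
* `OverPrime.prodAι : prodA A ⋙ ι ≅ prod.functor.flip.obj A` (identity components) and the `rfl`
  lemmas `prodA_obj_obj`, `prodA_map_hom`.

Pure category theory (any category with binary products); nothing refers to the IUT corpus and no side
is taken on any disputed claim.
-/

open CategoryTheory CategoryTheory.Limits

namespace Literature.AnabelianGeometry.SemiGraphs

namespace OverPrime

universe v u

variable {C : Type u} [Category.{v} C] [HasBinaryProducts C] (A : C)

/-- **`X ↦ (X × A → A)`**: the functor `C ⥤ C[A]` "given by taking the product with `A`" (the second
projection is the structure arrow). [cite: MochizukiSemiAnbd2006, §0 p.6] -/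
noncomputable def prodA : C ⥤ Over' A :=
  (admitsHomTo A).lift (prod.functor.flip.obj A) fun _ => ⟨prod.snd⟩

/-- On objects: `X ⨯ A`. [cite: MochizukiSemiAnbd2006, §0 p.6] -/
@[simp] theorem prodA_obj_obj (X : C) : ((prodA A).obj X).obj = (X ⨯ A) := rfl

/-- On arrows: `f ⨯ 𝟙_A`. [cite: MochizukiSemiAnbd2006, §0 p.6] -/
@[simp] theorem prodA_map_hom {X Y : C} (f : X ⟶ Y) : ((prodA A).map f).hom = prod.map f (𝟙 A) := rfl

/-- `prodA` followed by the inclusion `C[A] ⥤ C` is `X ↦ X ⨯ A` (identity components).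
[cite: MochizukiSemiAnbd2006, §0 p.6] -/
noncomputable def prodAι : prodA A ⋙ (admitsHomTo A).ι ≅ prod.functor.flip.obj A :=
  (admitsHomTo A).liftCompιIso _ _

/-- The components of `prodAι` are identities. [cite: MochizukiSemiAnbd2006, §0 p.6] -/
@[simp] theorem prodAι_hom_app (X : C) : (prodAι A).hom.app X = 𝟙 (X ⨯ A) := rfl

/-- The components of `prodAι⁻¹` are identities. [cite: MochizukiSemiAnbd2006, §0 p.6] -/
@[simp] theorem prodAι_inv_app (X : C) : (prodAι A).inv.app X = 𝟙 (X ⨯ A) := rfl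

/-- Every object of `C[A]` receives its "cover" `X ⨯ A → X` from an object in the image of `prodA`
(the first projection, as an arrow of `C[A]`). [cite: MochizukiSemiAnbd2006, Thm A.4 proof p.85] -/
noncomputable def prodAFst (X : Over' A) : (prodA A).obj X.obj ⟶ X :=
  ObjectProperty.homMk prod.fst

/-- `prodAFst` on arrows is `pr₁`. [cite: MochizukiSemiAnbd2006, Thm A.4 proof p.85] -/
@[simp] theorem prodAFst_hom (X : Over' A) : (prodAFst A X).hom = prod.fst := rfl

/-- `prodAFst` is natural in `X`. [cite: MochizukiSemiAnbd2006, Thm A.4 proof p.85] -/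
theorem prodAFst_naturality {X Y : Over' A} (f : X ⟶ Y) :
    (prodA A).map f.hom ≫ prodAFst A Y = prodAFst A X ≫ f := by
  ext
  change prod.map f.hom (𝟙 A) ≫ prod.fst = prod.fst ≫ f.hom
  rw [prod.map_fst]

end OverPrime

end Literature.AnabelianGeometry.SemiGraphs
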